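import Literature.AlgebraicGeometry.Motives.Varieties
import HarnessLib

/-!
# Quotients of `k`-schemes by a group of automorphisms, tested against separated `k`-schemes

Topic `AlgebraicGeometry/Motives`; namespace `Literature.AlgebraicGeometry.Motives`.  ONE predicate (no named fact, no
theorem; its elementary API — invariance, the universal property, cancellation against separated targets — is proved in
`Motives/TorsorCoproductQuotient.lean`).

For a field `k`, `k`-schemes `Y Z : SchemeOver k` (`= Over (Spec k)`), a family of `k`-automorphisms
`act : Δ → (Y ≅ Y)` and a `k`-morphism `p : Y ⟶ Z`, the predicate `IsSepQuotient act p` says that `p` is a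
**categorical quotient of `Y` by the `act g` for SEPARATED test objects**: `p` is invariant (`act g ≫ p = p`) and every
invariant `k`-morphism `f : Y ⟶ W` to a `k`-scheme `W` with `W → Spec k` separated factors UNIQUELY through `p`.
This is exactly the universal property that the tree's finite-group quotient `Motives.finiteQuotient ρ = Y/G`
(Mumford, *Abelian Varieties* §7, Theorem p. 66 and the Remark «`(Y, π)` is a categorical quotient»; SGA 1 V §1)
enjoys through `finiteQuotient.desc` / `finiteQuotient.mk_desc` / `finiteQuotient.desc_unique`
(`Motives/FiniteQuotient.lean`), packaged as a `Prop` so that statements ABOUT such quotients (base change,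
quotients of coproducts by a simply transitive permutation of the summands, functoriality in towers) can be phrased
without fixing a construction.

Design: `Δ` is a bare type and `act` a bare family (no `Group Δ`, no `Δ →* Aut Y`): the universal property only
sees the set of automorphisms `{act g}`.  Separatedness is the RELATIVE notion `IsSeparated W.hom` (over a field it is
equivalent to `W.left.IsSeparated`, which `finiteQuotient.desc` assumes).  Deliberately NOT here: any existence
statement (that is `Motives.finiteQuotient`), and nothing about points or cohomology.

Use (cell `hodgecm-mathlib`, fan B, rung B-I): the finite Hecke-quotient step of Deligne's construction of canonical
models ([Deligne1971TravauxShimura] Prop. 5.11, (5.11.1)) — files `Motives/TorsorCoproductQuotient.lean` and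
`Motives/FiniteQuotientBaseChange.lean`.

## References
* [MumfordAV1970] D. Mumford, *Abelian Varieties* (1970), §7 Theorem p. 66 and Remark (categorical quotient), §12.
* [SGA1] A. Grothendieck, M. Raynaud, *SGA 1*, Exp. V §1 (Prop. 1.1, 1.8).
-/

noncomputable section

open CategoryTheory AlgebraicGeometry

namespace Literature.AlgebraicGeometry.Motives

universe u v

variable {k : Type u} [Field k] {Δ : Type v} {Y Z : SchemeOver k}

/-- `p : Y ⟶ Z` (schemes over a field `k`) is a **quotient of `Y` by the automorphisms `act g`, `g : Δ`, for
separated test objects**: `p` is invariant under every `act g`, and every invariant `k`-morphism `f : Y ⟶ W` to a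
`k`-scheme `W` SEPARATED over `k` factors uniquely through `p` (Mumford's Remark «`(Y, π)` is a categorical
quotient», restricted to separated test objects — exactly what the tree's `Motives.finiteQuotient.desc` /
`desc_unique` provide).  A predicate; nothing asserted. [cite: MumfordAV1970, §7 Thm. p. 66 (Remark)] -/
def IsSepQuotient (act : Δ → (Y ≅ Y)) (p : Y ⟶ Z) : Prop :=
  (∀ g : Δ, (act g).hom ≫ p = p) ∧
    ∀ (W : SchemeOver k) (f : Y ⟶ W), IsSeparated W.hom → (∀ g : Δ, (act g).hom ≫ f = f) →
      ∃! fbar : Z ⟶ W, p ≫ fbar = f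

end Literature.AlgebraicGeometry.Motives

end
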